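import Literature.MathematicalPhysics.QuantumLattice.TorusSectorPartitionFnAllTori
import Literature.MathematicalPhysics.QuantumLattice.TorusSectorGibbsFillingBoxFreeEnergy
import HarnessLib

/-!
# The filling-box producer of the free-energy route binds EVERY torus-limit thermal state: thermal energy
# windows at every filling of a box interval from two open-box partition functions, along any `Ls → ∞`

Family `hubbard` (topic `MathematicalPhysics/QuantumLattice`; the thermodynamic-limit consumer of
`TorusSectorPartitionFnAllTori` (two open `a × a` box partition functions bound the canonical free energy of
EVERY large torus at every filling between the box densities, `O(L)` defect) through the `o(L²)`-tolerant
chord theorems of `TorusSectorGibbsFillingBoxFreeEnergy`). The producers of `TorusSectorGibbsOpenBoxBound`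
(commensurate fillings) and `TorusSectorGibbsFillingBoxFreeEnergy` (filling intervals) bind torus limits along
BOX-BUILT tori `L_j = K_j a` only; the torus-limit thermal convention of record — and the typed-box seam of the
material oracle (`holdsOn_thermalWord_phys`) — quantify over ALL `Ls → ∞`. Here the restriction is removed:
for `p + 1 ≤ a²`, a filling `n ∈ [2p/a², 2(p+1)/a²)` (half-open; the right end point is the left end point of
the next pair `(p+1, p+2)`), certified floors `0 < z_p ≤ Re Z_β(box; p,p)`, `0 < z_q ≤ Re Z_β(box; p+1,p+1)` of the
open `a × a` box, `chord(n) = (log z_p + (na²/2 − p)(log z_q − log z_p))/a²`, and EVERY torus limit `ω` of the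
canonical sector Gibbs states at `(β; t,t',U; n)` along ANY `Ls → ∞`:

* §1 `eventually_sub_mul_sq_le_of_linear_defect` (an `O(L)` defect is `o(L²)`) and
  `eventually_chord_sub_mul_sq_le_log_partitionFn_allTori`: for every `ε > 0`, eventually
  `(chord(n) − ε)·L_j² ≤ log Re Z_β(sectorHamiltonianTT' t t' U n L_j)`;
* §2 THE PRODUCERS FOR EVERY TORUS LIMIT: I `…le_entropy_sub_chord_div_of_fillingBox_allTori`
  `e_Φ(ω) ≤ (s − chord(n))/β` (`2H_b(n/2) < s`); II `…le_hot_sub_chord_div_of_fillingBox_allTori`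
  `e_Φ(ω) ≤ (u_h − chord(n))/(β − β_h)` from a hot free-energy bound with constant defect; III
  `…le_grandCanonical_sub_chord_div_of_fillingBox_allTori` `e_Φ(ω) ≤ (P − β_h μ n − chord(n))/(β − β_h)` from ONE
  grand-canonical pressure bound; IV `chord_sub_cold_div_le_meanEnergy_hubbardTTPrime_of_fillingBox_allTori`
  `(chord(n) − u_c)/(β_c − β) ≤ e_Φ(ω)` from a cold free-energy bound; and the interval-uniform form with
  `min(log z_p, log z_q)/a²` in place of the chord.
* §3 COMMENSURATE FILLINGS FROM ONE BOX for every torus limit (`…le_entropy_sub_log_openBox_div_allTori`,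
  `n = 2p/a²`; the second box floor is discharged by positivity) and the HEADLINE `n = 7/8`
  (`…le_of_openBox_seven_eighths_allTori`: `e_Φ(ω) ≤ (1.371 − log z/16)/β` for EVERY torus limit, any `Ls → ∞`,
  from one certified `0 < z ≤ Re Z_β(H^open_{4×4}; 7, 7)` — the all-`Ls` upgrade of the producer of record).
These are word shapes `∀ Ls ω, Tendsto Ls atTop atTop → IsTorusLimitOfMixture … Ls → P ω` — exactly what the
scale-box / typed-box seams consume.

HONEST SCOPE: transport/producer lemmas — no number, no certificate, no phase word, no thermodynamic-limit
free-energy function. Everything is PROVED; no definition, no named fact.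

## References

* D. Ruelle, *Statistical Mechanics: Rigorous Results* (1969), §2.5–2.6, §3.3 (3.11)–(3.18), §3.4.
  [cite: Ruelle1969, §3.3 (3.11)–(3.18); §3.4]
* R. B. Israel, *Convexity in the Theory of Lattice Gases* (1979), Lemma II.3.1. [cite: Israel1979, Lemma II.3.1]
* J. P. F. LeBlanc et al., Phys. Rev. X 5 (2015) 041041, eq. (1). [cite: LeBlancEtAl2015, eq. (1)]
-/

noncomputable section

namespace Literature.MathematicalPhysics.QuantumLattice

open Matrix Finset HubbardWave0 ThermodynamicLimit LiebThm1 Literature.Probability.LatticeModels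
open _root_.Filter
open scoped _root_.Topology ComplexOrder BigOperators

/-! ### §1 The chord floor along every sequence of tori -/

section Floor

/-- An `O(L)` defect in a per-volume lower bound is an `o(L²)` defect: `ℓ·L_j² − C·L_j − D ≤ F_j` eventually
and `L_j → ∞` give `(ℓ − ε)·L_j² ≤ F_j` eventually, for every `ε > 0`. [cite: Ruelle1969, §3.3 (3.13)–(3.15)] -/
theorem eventually_sub_mul_sq_le_of_linear_defect {Ls : ℕ → ℕ} (hLs : Tendsto Ls atTop atTop)
    {F : ℕ → ℝ} {ℓ C D : ℝ} (h : ∀ᶠ j in atTop, ℓ * (Ls j : ℝ) ^ 2 - C * (Ls j : ℝ) - D ≤ F j) {ε : ℝ}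
    (hε : 0 < ε) : ∀ᶠ j in atTop, (ℓ - ε) * (Ls j : ℝ) ^ 2 ≤ F j := by
  have hR : Tendsto (fun j => (Ls j : ℝ)) atTop atTop := tendsto_natCast_atTop_atTop.comp hLs
  filter_upwards [h, hR.eventually_ge_atTop (max 1 ((|C| + |D|) / ε))] with j hj hL
  have h1 : (1 : ℝ) ≤ Ls j := le_trans (le_max_left _ _) hL
  have h2 : (|C| + |D|) / ε ≤ Ls j := le_trans (le_max_right _ _) hL
  rw [div_le_iff₀ hε] at h2
  have hC : C * (Ls j : ℝ) ≤ |C| * (Ls j : ℝ) := mul_le_mul_of_nonneg_right (le_abs_self C) (by linarith)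
  have hD : D ≤ |D| * (Ls j : ℝ) := by
    calc D ≤ |D| := le_abs_self D
      _ = |D| * 1 := (mul_one _).symm
      _ ≤ |D| * (Ls j : ℝ) := mul_le_mul_of_nonneg_left h1 (abs_nonneg D)
  have h3 : (|C| + |D|) * (Ls j : ℝ) ≤ ε * (Ls j : ℝ) ^ 2 := by
    nlinarith [mul_le_mul_of_nonneg_right h2 (show (0 : ℝ) ≤ Ls j by linarith)]
  nlinarith

variable {Ls : ℕ → ℕ}

/-- **The chord free-energy floor along EVERY sequence of tori, `o(L²)`-tolerant form.** For `p + 1 ≤ a²`,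
`2p/a² ≤ n < 2(p+1)/a²`, certified floors `0 < z_p ≤ Re Z_β(box; p,p)`, `0 < z_q ≤ Re Z_β(box; p+1,p+1)` (`β ≥ 0`)
and ANY `Ls → ∞`: for every `ε > 0`, eventually `(chord(n) − ε)·L_j² ≤ log Re Z_β(sectorHamiltonianTT' t t' U n L_j)`.
[cite: Ruelle1969, §3.3 (3.11)–(3.18)] [cite: Israel1979, Lemma II.3.1] -/
theorem eventually_chord_sub_mul_sq_le_log_partitionFn_allTori (t t' U n : ℝ) {β : ℝ} (hβ : 0 ≤ β)
    {a p : ℕ} (ha : 1 ≤ a) (hp : p + 1 ≤ a * a)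
    (hlo : 2 * (p : ℝ) / (a : ℝ) ^ 2 ≤ n) (hhi : n < 2 * ((p : ℝ) + 1) / (a : ℝ) ^ 2)
    {zp zq : ℝ} (hzp0 : 0 < zp)
    (hzp : zp ≤ (partitionFn β (spinSectorHamiltonian p p (hubbardOpenBoxTT' a a t t' U))).re)
    (hzq0 : 0 < zq)
    (hzq : zq ≤ (partitionFn β (spinSectorHamiltonian (p + 1) (p + 1) (hubbardOpenBoxTT' a a t t' U))).re)
    (hLs : Tendsto Ls atTop atTop) {ε : ℝ} (hε : 0 < ε) :
    ∀ᶠ j in atTop,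
      ((Real.log zp + (n * (a : ℝ) ^ 2 / 2 - p) * (Real.log zq - Real.log zp)) / (a : ℝ) ^ 2 - ε) *
          (Ls j : ℝ) ^ 2 ≤
        Real.log (partitionFn β (sectorHamiltonianTT' t t' U n (Ls j))).re := by
  have hn0 : 0 ≤ n := le_trans (by positivity) hlo
  refine eventually_sub_mul_sq_le_of_linear_defect hLs
    (C := 2 / (a : ℝ) * |Real.log zp - p * (Real.log zq - Real.log zp)|) (D := |Real.log zq - Real.log zp|)
    ?_ hε
  filter_upwards [hLs.eventually_ge_atTop (a * (a + 1)),
    hLs.eventually (eventually_halfRectN_le_sq_div_mul_succ (p := p) ha hhi)] with j hj hkhi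
  obtain ⟨hK, hrK, hr, hL⟩ := twoScale_decomposition ha hj
  have hKa : ((Ls j / a : ℕ) : ℝ) * a ≤ (Ls j : ℕ) := by exact_mod_cast Nat.div_mul_le_self (Ls j) a
  have hklo : Ls j / a * (Ls j / a) * p ≤ halfRectN n (Ls j) := sq_mul_le_halfRectN_of_mul_le ha hKa hlo
  have h := chord_mul_sq_sub_linear_le_log_partitionFn_sectorHamiltonianTT' t t' U hβ ha hK hrK hr hL hp hn0
    hklo hkhi hzp0 hzp hzq0 hzq
  linarith

end Floor

/-! ### §2 The producers for every torus-limit thermal state -/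

namespace InfVolFermionState

variable {t t' U n β : ℝ} {ω : InfVolFermionState 2} {Ls : ℕ → ℕ}

/-- **FILLING-BOX PRODUCER I for EVERY torus limit — two box partition functions alone.** Let `p + 1 ≤ a²`
(`a ≥ 1`), `2p/a² ≤ n < 2(p+1)/a²`, let `ω` be a torus limit of the canonical sector Gibbs states of the `t–t'`
Hubbard model at `(β; n)`, `β > 0`, along ANY `Ls → ∞`, and let `0 < z_p ≤ Re Z_β(H^open_{a×a}(t,t',U); p,p)`,
`0 < z_q ≤ Re Z_β(H^open_{a×a}(t,t',U); p+1,p+1)`. Then for every `s > 2H_b(n/2)`,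
`e_{Φ(t,t',U)}(ω) ≤ (s − (log z_p + λ(log z_q − log z_p))/a²)/β`, `λ = na²/2 − p`.
[cite: Ruelle1969, §3.3 (3.11)–(3.18); §3.4] [cite: Israel1979, Lemma II.3.1] -/
theorem IsTorusLimitOfMixture.meanEnergy_hubbardTTPrime_le_entropy_sub_chord_div_of_fillingBox_allTori
    {a p : ℕ} (ha : 1 ≤ a) (hp : p + 1 ≤ a * a)
    (hlo : 2 * (p : ℝ) / (a : ℝ) ^ 2 ≤ n) (hhi : n < 2 * ((p : ℝ) + 1) / (a : ℝ) ^ 2)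
    (h : ω.IsTorusLimitOfMixture (sectorGibbsCount n) (fun L => sectorGibbsWeightTT' β t t' U n L)
      (fun L => sectorGibbsVectorTT' t t' U n L) Ls)
    (hLs : Tendsto Ls atTop atTop) (hβ : 0 < β)
    {zp zq : ℝ} (hzp0 : 0 < zp)
    (hzp : zp ≤ (partitionFn β (spinSectorHamiltonian p p (hubbardOpenBoxTT' a a t t' U))).re)
    (hzq0 : 0 < zq)
    (hzq : zq ≤ (partitionFn β (spinSectorHamiltonian (p + 1) (p + 1) (hubbardOpenBoxTT' a a t t' U))).re)
    {s : ℝ} (hs : 2 * Real.binEntropy (n / 2) < s) :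
    ω.meanEnergy (hubbardTTPrimeFermionInteraction t t' U) 1 ≤
      (s - (Real.log zp + (n * (a : ℝ) ^ 2 / 2 - p) * (Real.log zq - Real.log zp)) / (a : ℝ) ^ 2) / β := by
  obtain ⟨hn0, hn2⟩ := filling_bounds_of_box_interval ha hp hlo hhi.le
  exact h.meanEnergy_hubbardTTPrime_le_entropy_sub_div_of_sectorGibbs_of_forall_pos hn0 hn2 hLs hβ
    (fun ε hε => eventually_chord_sub_mul_sq_le_log_partitionFn_allTori t t' U n hβ.le ha hp hlo hhi hzp0 hzp
      hzq0 hzq hLs hε)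
    (hLs.eventually (eventually_log_sectorGibbsCount_le hn0 hn2 hs))

/-- **FILLING-BOX PRODUCER II for EVERY torus limit — hot chord** (`0 < β_h < β`): with the data of
producer I and a hot free-energy bound with a constant defect `log Re Z_{β_h}(sector n, L_j) ≤ u_h·L_j² + C`
eventually, `e_{Φ(t,t',U)}(ω) ≤ (u_h − chord(n))/(β − β_h)`. [cite: Ruelle1969, §2.5–2.6, §3.3 (3.11)–(3.18)]
[cite: Israel1979, Lemma II.3.1] -/
theorem IsTorusLimitOfMixture.meanEnergy_hubbardTTPrime_le_hot_sub_chord_div_of_fillingBox_allTori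
    {a p : ℕ} (ha : 1 ≤ a) (hp : p + 1 ≤ a * a)
    (hlo : 2 * (p : ℝ) / (a : ℝ) ^ 2 ≤ n) (hhi : n < 2 * ((p : ℝ) + 1) / (a : ℝ) ^ 2)
    (h : ω.IsTorusLimitOfMixture (sectorGibbsCount n) (fun L => sectorGibbsWeightTT' β t t' U n L)
      (fun L => sectorGibbsVectorTT' t t' U n L) Ls)
    (hLs : Tendsto Ls atTop atTop) {βh : ℝ} (hβh : 0 < βh) (hlt : βh < β)
    {zp zq : ℝ} (hzp0 : 0 < zp)
    (hzp : zp ≤ (partitionFn β (spinSectorHamiltonian p p (hubbardOpenBoxTT' a a t t' U))).re)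
    (hzq0 : 0 < zq)
    (hzq : zq ≤ (partitionFn β (spinSectorHamiltonian (p + 1) (p + 1) (hubbardOpenBoxTT' a a t t' U))).re)
    {uh C : ℝ}
    (huh : ∀ᶠ j in atTop, Real.log (partitionFn βh (sectorHamiltonianTT' t t' U n (Ls j))).re ≤
      uh * (Ls j : ℝ) ^ 2 + C) :
    ω.meanEnergy (hubbardTTPrimeFermionInteraction t t' U) 1 ≤
      (uh - (Real.log zp + (n * (a : ℝ) ^ 2 / 2 - p) * (Real.log zq - Real.log zp)) / (a : ℝ) ^ 2) /
        (β - βh) := by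
  obtain ⟨hn0, hn2⟩ := filling_bounds_of_box_interval ha hp hlo hhi.le
  exact h.meanEnergy_hubbardTTPrime_le_chord_of_sectorGibbs_of_forall_pos hn0 hn2 hLs hβh hlt
    (fun ε hε => eventually_chord_sub_mul_sq_le_log_partitionFn_allTori t t' U n (hβh.le.trans hlt.le) ha hp
      hlo hhi hzp0 hzp hzq0 hzq hLs hε)
    (fun ε hε => eventually_le_add_mul_sq_of_le_add_const hLs huh hε)

/-- **FILLING-BOX PRODUCER III for EVERY torus limit — hot chord from ONE grand-canonical pressure bound**
(`0 < β_h < β`, any `μ`): an eventual bound `log Re Z_{β_h}(H_{L_j}(t,t',U) − μN) ≤ P·L_j²` gives, at every filling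
of the interval, `e_{Φ(t,t',U)}(ω) ≤ (P − β_h μ n − chord(n))/(β − β_h)`.
[cite: Ruelle1969, §2.5–2.6, §3.3 (3.11)–(3.18), §3.4] [cite: Israel1979, Lemma II.3.1] -/
theorem IsTorusLimitOfMixture.meanEnergy_hubbardTTPrime_le_grandCanonical_sub_chord_div_of_fillingBox_allTori
    {a p : ℕ} (ha : 1 ≤ a) (hp : p + 1 ≤ a * a)
    (hlo : 2 * (p : ℝ) / (a : ℝ) ^ 2 ≤ n) (hhi : n < 2 * ((p : ℝ) + 1) / (a : ℝ) ^ 2)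
    (h : ω.IsTorusLimitOfMixture (sectorGibbsCount n) (fun L => sectorGibbsWeightTT' β t t' U n L)
      (fun L => sectorGibbsVectorTT' t t' U n L) Ls)
    (hLs : Tendsto Ls atTop atTop) {βh : ℝ} (hβh : 0 < βh) (hlt : βh < β)
    {zp zq : ℝ} (hzp0 : 0 < zp)
    (hzp : zp ≤ (partitionFn β (spinSectorHamiltonian p p (hubbardOpenBoxTT' a a t t' U))).re)
    (hzq0 : 0 < zq)
    (hzq : zq ≤ (partitionFn β (spinSectorHamiltonian (p + 1) (p + 1) (hubbardOpenBoxTT' a a t t' U))).re)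
    (μ : ℝ) {P : ℝ}
    (hP : ∀ᶠ j in atTop, Real.log (partitionFn βh (hubbardTorusTT' (Ls j) t t' U -
      (μ : ℂ) • totalNumber)).re ≤ P * (Ls j : ℝ) ^ 2) :
    ω.meanEnergy (hubbardTTPrimeFermionInteraction t t' U) 1 ≤
      (P - βh * μ * n -
          (Real.log zp + (n * (a : ℝ) ^ 2 / 2 - p) * (Real.log zq - Real.log zp)) / (a : ℝ) ^ 2) /
        (β - βh) := by
  obtain ⟨hn0, hn2⟩ := filling_bounds_of_box_interval ha hp hlo hhi.le
  exact h.meanEnergy_hubbardTTPrime_le_hot_sub_chord_div_of_fillingBox_allTori ha hp hlo hhi hLs hβh hlt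
    hzp0 hzp hzq0 hzq (eventually_log_partitionFn_sectorHamiltonianTT'_le_of_grandCanonical t t' U hn0 hn2
      βh μ hP)

/-- **FILLING-BOX PRODUCER IV for EVERY torus limit — cold chord, a thermal energy FLOOR** (`0 < β < β_c`):
with the data of producer I and a cold free-energy bound with a constant defect,
`(chord(n) − u_c)/(β_c − β) ≤ e_{Φ(t,t',U)}(ω)`. [cite: Ruelle1969, §2.5–2.6, §3.3 (3.11)–(3.18)]
[cite: Israel1979, Lemma II.3.1] -/
theorem IsTorusLimitOfMixture.chord_sub_cold_div_le_meanEnergy_hubbardTTPrime_of_fillingBox_allTori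
    {a p : ℕ} (ha : 1 ≤ a) (hp : p + 1 ≤ a * a)
    (hlo : 2 * (p : ℝ) / (a : ℝ) ^ 2 ≤ n) (hhi : n < 2 * ((p : ℝ) + 1) / (a : ℝ) ^ 2)
    (h : ω.IsTorusLimitOfMixture (sectorGibbsCount n) (fun L => sectorGibbsWeightTT' β t t' U n L)
      (fun L => sectorGibbsVectorTT' t t' U n L) Ls)
    (hLs : Tendsto Ls atTop atTop) {βc : ℝ} (hβ : 0 < β) (hlt : β < βc)
    {zp zq : ℝ} (hzp0 : 0 < zp)
    (hzp : zp ≤ (partitionFn β (spinSectorHamiltonian p p (hubbardOpenBoxTT' a a t t' U))).re)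
    (hzq0 : 0 < zq)
    (hzq : zq ≤ (partitionFn β (spinSectorHamiltonian (p + 1) (p + 1) (hubbardOpenBoxTT' a a t t' U))).re)
    {uc C : ℝ}
    (huc : ∀ᶠ j in atTop, Real.log (partitionFn βc (sectorHamiltonianTT' t t' U n (Ls j))).re ≤
      uc * (Ls j : ℝ) ^ 2 + C) :
    ((Real.log zp + (n * (a : ℝ) ^ 2 / 2 - p) * (Real.log zq - Real.log zp)) / (a : ℝ) ^ 2 - uc) /
        (βc - β) ≤
      ω.meanEnergy (hubbardTTPrimeFermionInteraction t t' U) 1 := by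
  obtain ⟨hn0, hn2⟩ := filling_bounds_of_box_interval ha hp hlo hhi.le
  exact h.chord_le_meanEnergy_hubbardTTPrime_of_sectorGibbs_of_forall_pos hn0 hn2 hLs hβ hlt
    (fun ε hε => eventually_chord_sub_mul_sq_le_log_partitionFn_allTori t t' U n hβ.le ha hp hlo hhi hzp0 hzp
      hzq0 hzq hLs hε)
    (fun ε hε => eventually_le_add_mul_sq_of_le_add_const hLs huc hε)

/-- **PRODUCER I for every torus limit, interval-uniform coarse form**: under the hypotheses of producer I,
`e_{Φ(t,t',U)}(ω) ≤ (s − min(log z_p, log z_q)/a²)/β`. [cite: Ruelle1969, §3.3 (3.11)–(3.18)]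
[cite: Israel1979, Lemma II.3.1] -/
theorem IsTorusLimitOfMixture.meanEnergy_hubbardTTPrime_le_entropy_sub_min_div_of_fillingBox_allTori
    {a p : ℕ} (ha : 1 ≤ a) (hp : p + 1 ≤ a * a)
    (hlo : 2 * (p : ℝ) / (a : ℝ) ^ 2 ≤ n) (hhi : n < 2 * ((p : ℝ) + 1) / (a : ℝ) ^ 2)
    (h : ω.IsTorusLimitOfMixture (sectorGibbsCount n) (fun L => sectorGibbsWeightTT' β t t' U n L)
      (fun L => sectorGibbsVectorTT' t t' U n L) Ls)
    (hLs : Tendsto Ls atTop atTop) (hβ : 0 < β)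
    {zp zq : ℝ} (hzp0 : 0 < zp)
    (hzp : zp ≤ (partitionFn β (spinSectorHamiltonian p p (hubbardOpenBoxTT' a a t t' U))).re)
    (hzq0 : 0 < zq)
    (hzq : zq ≤ (partitionFn β (spinSectorHamiltonian (p + 1) (p + 1) (hubbardOpenBoxTT' a a t t' U))).re)
    {s : ℝ} (hs : 2 * Real.binEntropy (n / 2) < s) :
    ω.meanEnergy (hubbardTTPrimeFermionInteraction t t' U) 1 ≤
      (s - min (Real.log zp) (Real.log zq) / (a : ℝ) ^ 2) / β := by
  have h1 := h.meanEnergy_hubbardTTPrime_le_entropy_sub_chord_div_of_fillingBox_allTori ha hp hlo hhi hLs hβ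
    hzp0 hzp hzq0 hzq hs
  have h2 := min_log_div_sq_le_chord ha hlo hhi.le zp zq
  refine h1.trans (div_le_div_of_nonneg_right ?_ hβ.le)
  linarith

end InfVolFermionState

/-! ### §3 Commensurate fillings from ONE box, for every torus limit; the headline `n = 7/8` -/

section Commensurate

namespace InfVolFermionState

variable {t t' U β : ℝ} {ω : InfVolFermionState 2} {Ls : ℕ → ℕ}

/-- **ONE open box bounds every torus limit at the box density** (the all-`Ls` upgrade of the commensurate
producer `…le_entropy_sub_log_openBox_div_of_sectorGibbs` of `TorusSectorGibbsOpenBoxBound`, which needed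
box-built tori): for `p + 1 ≤ a²`, `n = 2p/a²`, every torus limit `ω` of the canonical sector Gibbs states at
`(β; n)` along ANY `Ls → ∞`, every `0 < z ≤ Re Z_β(H^open_{a×a}(t,t',U); p, p)` and every `s > 2H_b(n/2)`:
`e_{Φ(t,t',U)}(ω) ≤ (s − log z / a²)/β` (the second box floor of the interval producer is discharged by the
positivity of the `(p+1, p+1)` box partition function; its value does not enter at `λ = 0`).
[cite: Ruelle1969, §3.3 (3.11)–(3.18); §3.4] [cite: Israel1979, Lemma II.3.1] -/
theorem IsTorusLimitOfMixture.meanEnergy_hubbardTTPrime_le_entropy_sub_log_openBox_div_allTori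
    {a p : ℕ} (ha : 1 ≤ a) (hp : p + 1 ≤ a * a) {n : ℝ} (hn : n = 2 * (p : ℝ) / (a : ℝ) ^ 2)
    (h : ω.IsTorusLimitOfMixture (sectorGibbsCount n) (fun L => sectorGibbsWeightTT' β t t' U n L)
      (fun L => sectorGibbsVectorTT' t t' U n L) Ls)
    (hLs : Tendsto Ls atTop atTop) (hβ : 0 < β) {z : ℝ} (hz0 : 0 < z)
    (hz : z ≤ (partitionFn β (spinSectorHamiltonian p p (hubbardOpenBoxTT' a a t t' U))).re)
    {s : ℝ} (hs : 2 * Real.binEntropy (n / 2) < s) :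
    ω.meanEnergy (hubbardTTPrimeFermionInteraction t t' U) 1 ≤ (s - Real.log z / (a : ℝ) ^ 2) / β := by
  have ha0 : (0 : ℝ) < (a : ℝ) := by exact_mod_cast ha
  have ha' : (0 : ℝ) < (a : ℝ) ^ 2 := by positivity
  haveI : Nonempty (Subtype (spinConfig (Λ := Fin a ×ₗ Fin a) (p + 1) (p + 1))) :=
    nonempty_spinConfig (by rw [card_rectSites]; exact hp) (by rw [card_rectSites]; exact hp)
  have hq0 : 0 < (partitionFn β (spinSectorHamiltonian (p + 1) (p + 1) (hubbardOpenBoxTT' a a t t' U))).re :=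
    partitionFn_spinSector_re_pos (hubbardOpenBoxTT'_isHermitian a a t t' U) β
  have hlo : 2 * (p : ℝ) / (a : ℝ) ^ 2 ≤ n := hn.ge
  have hhi : n < 2 * ((p : ℝ) + 1) / (a : ℝ) ^ 2 := by
    rw [hn]; exact div_lt_div_of_pos_right (by linarith) ha'
  have h1 := h.meanEnergy_hubbardTTPrime_le_entropy_sub_chord_div_of_fillingBox_allTori ha hp hlo hhi hLs hβ
    hz0 hz hq0 le_rfl hs
  have hlam : n * (a : ℝ) ^ 2 / 2 - p = 0 := by
    rw [hn]; field_simp; ring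
  rw [hlam, zero_mul, add_zero] at h1
  exact h1

/-- `2 log 2 + (log 3)/2 + 1/98 ≤ log 7` (re-derived; private in `TorusSectorGibbsOpenBoxBound`). [folklore] -/
private theorem two_mul_log_two_add_half_log_three_add_le_log_seven'' :
    2 * Real.log 2 + Real.log 3 / 2 + 1 / 98 ≤ Real.log 7 := by
  have h49 : Real.log 49 = 2 * Real.log 7 := by
    rw [show (49 : ℝ) = 7 ^ 2 by norm_num, Real.log_pow]; norm_num
  have h48 : Real.log 48 = 4 * Real.log 2 + Real.log 3 := by
    rw [show (48 : ℝ) = 2 ^ 4 * 3 by norm_num, Real.log_mul (by norm_num) (by norm_num), Real.log_pow]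
    norm_num
  have hq : 1 - (49 / 48 : ℝ)⁻¹ ≤ Real.log (49 / 48) := Real.one_sub_inv_le_log_of_pos (by norm_num)
  have hdiv : Real.log (49 / 48) = Real.log 49 - Real.log 48 :=
    Real.log_div (by norm_num) (by norm_num)
  rw [hdiv, h49, h48] at hq
  norm_num at hq
  linarith

/-- `2·H_b((7/8)/2) < 1371/1000` (re-derived; private in `TorusSectorGibbsOpenBoxBound`). [folklore] -/
private theorem two_mul_binEntropy_half_seven_div_eight_lt' :
    2 * Real.binEntropy (7 / 8 / 2) < 1371 / 1000 := by
  rw [show (7 / 8 / 2 : ℝ) = 7 / 16 by norm_num]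
  have hid : 2 * Real.binEntropy (7 / 16) =
      8 * Real.log 2 - 7 / 8 * Real.log 7 - 9 / 4 * Real.log 3 := by
    have h16 : Real.log 16 = 4 * Real.log 2 := by
      rw [show (16 : ℝ) = 2 ^ 4 by norm_num, Real.log_pow]; norm_num
    have h9 : Real.log 9 = 2 * Real.log 3 := by
      rw [show (9 : ℝ) = 3 ^ 2 by norm_num, Real.log_pow]; norm_num
    rw [Real.binEntropy, show (1 - 7 / 16 : ℝ) = 9 / 16 by norm_num, inv_div, inv_div,
      Real.log_div (by norm_num) (by norm_num), Real.log_div (by norm_num) (by norm_num), h16, h9]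
    ring
  rw [hid]
  linarith [Real.log_two_lt_d9, Real.log_three_gt_d9,
    two_mul_log_two_add_half_log_three_add_le_log_seven'']

/-- **Headline producer at filling `7/8` for EVERY torus limit** (the all-`Ls` upgrade of
`…meanEnergy_hubbardTTPrime_le_of_openBox_seven_eighths`, which was stated along `L_j = 4(j+2)` only): for every
torus limit `ω` of the canonical sector Gibbs states of the `t–t'` Hubbard model at `n = 7/8` and `β > 0` along ANY
`Ls → ∞`, and every certified number `0 < z ≤ Re Z_β(H^open_{4×4}(t,t',U); 7, 7)`,
`e_{Φ(t,t',U)}(ω) ≤ (1.371 − log z / 16)/β`. [cite: Israel1979, Lemma II.3.1] [cite: Ruelle1969, §3.3 (3.11)–(3.18)] -/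
theorem IsTorusLimitOfMixture.meanEnergy_hubbardTTPrime_le_of_openBox_seven_eighths_allTori
    (h : ω.IsTorusLimitOfMixture (sectorGibbsCount (7 / 8))
      (fun L => sectorGibbsWeightTT' β t t' U (7 / 8) L) (fun L => sectorGibbsVectorTT' t t' U (7 / 8) L) Ls)
    (hLs : Tendsto Ls atTop atTop) (hβ : 0 < β) {z : ℝ} (hz0 : 0 < z)
    (hz : z ≤ (partitionFn β (spinSectorHamiltonian 7 7 (hubbardOpenBoxTT' 4 4 t t' U))).re) :
    ω.meanEnergy (hubbardTTPrimeFermionInteraction t t' U) 1 ≤ (1371 / 1000 - Real.log z / 16) / β := by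
  have hn : (7 / 8 : ℝ) = 2 * ((7 : ℕ) : ℝ) / ((4 : ℕ) : ℝ) ^ 2 := by norm_num
  have h16 : (((4 : ℕ) : ℝ)) ^ 2 = 16 := by norm_num
  have h := h.meanEnergy_hubbardTTPrime_le_entropy_sub_log_openBox_div_allTori (a := 4) (p := 7) (by norm_num)
    (by norm_num) hn hLs hβ hz0 hz two_mul_binEntropy_half_seven_div_eight_lt'
  rw [h16] at h
  exact h

end InfVolFermionState

end Commensurate

end Literature.MathematicalPhysics.QuantumLattice
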